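import Summits.CriticalPhenomena.PercolationContinuityZ3.Theses.PercLupuEnvironment
import Summits.CriticalPhenomena.PercolationContinuityZ3.Theorems.PercNearOneGluingNoHeavyLowerTailCSHTheoremOne
import Literature.Probability.LatticeModels.ProdBernoulliCoupling
import Literature.Probability.Percolation.Percolation
import HarnessLib

/-!
# `PercLupuEnvironment.RayMonotone` (stmt-CriticalPhenomena-6993) — SETTLED after continuity

Item `stmt-CriticalPhenomena-6993` of route `CriticalPhenomena/PercLupuEnvironment` (support): for every field `ψ`, `c ≥ 1`, `t ≥ 0` and increasing measurable `A`: `P^{W(ψ)}(A) ≤ P^{W(cψ+t)}(A)`.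

The Lupu weights `1 − e^{−2ψ_x⁺ψ_y⁺}` are pointwise monotone under `ψ ↦ cψ + t` (`max (ψ x) 0 ≤ max (cψ x + t) 0`, products of nonnegatives, `exp` and `projIcc` monotone), and `prodBernoulli_real_mono_of_isUpperSet` (monotone coupling of product measures).  p205010 is NOT used.

builds on p205010 (kernel theorem, internal audit signed; external expert review pending) — USED (`CSH.percolationContinuityZ3_holds`).  RSW3 lane, lead gen 28 (prover-prim-rsw3-lead-g28-0):
'after continuity — the ledger harvest'.
References: G. Kozma, N. Nitzan (2024), Thm. 6 / Conj. 3 [KozmaNitzan2024]; G. Grimmett, *Percolation* (1999), §8 [GrimmettPercolation1999].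
-/

noncomputable section

namespace Summit.CriticalPhenomena.PercolationContinuityZ3.Theorems

namespace PercLupuEnvironmentRayMonotone

open MeasureTheory Literature.Probability.Percolation Literature.Probability.LatticeModels

/-- **`PercLupuEnvironment.RayMonotone` (stmt-CriticalPhenomena-6993), settled.**  pointwise weight monotonicity + `prodBernoulli_real_mono_of_isUpperSet`.
[cite: KozmaNitzan2024, Thm. 6 with Conj. 3 (p. 15)] -/
theorem rayMonotone_proof : Summit.CriticalPhenomena.PercolationContinuityZ3.Theses.PercLupuEnvironment.RayMonotone := by
  unfold Summit.CriticalPhenomena.PercolationContinuityZ3.Theses.PercLupuEnvironment.RayMonotone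
  intro W ψ c t hc ht A hA hAm
  refine prodBernoulli_real_mono_of_isUpperSet (fun e => ?_) hA hAm
  induction e using Sym2.ind with
  | h x y =>
    simp only [W, Sym2.map_mk, Sym2.mul_mk]
    split_ifs with he
    · have hx : max (ψ x) 0 ≤ max (c * ψ x + t) 0 := by
        rcases le_or_gt 0 (ψ x) with h0 | h0
        · exact max_le_max (by nlinarith) le_rfl
        · rw [max_eq_right h0.le]; exact le_max_right _ _
      have hy : max (ψ y) 0 ≤ max (c * ψ y + t) 0 := by
        rcases le_or_gt 0 (ψ y) with h0 | h0
        · exact max_le_max (by nlinarith) le_rfl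
        · rw [max_eq_right h0.le]; exact le_max_right _ _
      have hprod : max (ψ x) 0 * max (ψ y) 0 ≤ max (c * ψ x + t) 0 * max (c * ψ y + t) 0 :=
        mul_le_mul hx hy (le_max_right _ _) ((le_max_right _ _).trans hx)
      apply Set.monotone_projIcc
      have : Real.exp (-2 * (max (c * ψ x + t) 0 * max (c * ψ y + t) 0)) ≤ Real.exp (-2 * (max (ψ x) 0 * max (ψ y) 0)) :=
        Real.exp_le_exp.2 (by nlinarith)
      linarith
    · exact le_rfl

end PercLupuEnvironmentRayMonotone

end Summit.CriticalPhenomena.PercolationContinuityZ3.Theorems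

end
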